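import Summits.ResolutionOfSingularities.ResolutionOfSingularities.Theorems.PurelyInseparableDim4JointWaitingKid
import Summits.ResolutionOfSingularities.ResolutionOfSingularities.Theorems.PurelyInseparableDim4CentreAdmissible
import Literature.AlgebraicGeometry.Resolution.PointBlowupMohBound
import HarnessLib

/-!
# Purely inseparable four-folds: the WAITING KID with TRANSLATED BOUNDARY SHAPE — waiting regions that MEET the boundary
# (brick S3 (c) «joint point∘coordinate chains», part 58 = v3 HEREDITARY waiting, geometric half; cell `res-dim4-pi`)

[OURS · counted 0] (D-0157 DOOR 2; desk WORD #66 (4)(c), #74 (g), #99 (d); frame `PIDim4.TerminationImpliesOrderReduction`, S3 (c)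
v3, memo `S3c-V3LITE-LANDED.md` successor item 5 / `HANDOFF.md` (typ-3 g5) step 3 (b); host item stmt-ResolutionOfSingularities-16155,
helper). Nothing here proves resolution of singularities in dimension ≥ 4 / characteristic `p` — NOT here, not anywhere in this programme.

Part 44 (`waiting_kid_package_of_sees`) asks every OLD boundary component of the host's marked ideal to MISS the waiting region — the
designed limit of the threading chain 51–55: a waiting member hosted INSIDE an exceptional divisor (a child of the forest hosting a
waiting sibling, «hereditary waiting») always meets that divisor. Here the disjointness is replaced by what part 20's coordinate-member
invariant already carries for the host: a TRANSLATED SHAPE — every old component meeting the waiting region reads `ψ^* V(x_{idx D} + cst D)`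
on the host chart, with `cst D = 0` when `idx D ∈ S`, indices injective on the meeting components — and the shape is TRANSPORTED to the
kid exactly as typ-2's `ChartDictionary.shapeT_transform_zigzag` transports it to a child (readings `(idx D, cst D + c_{idx D})` for the
strict transforms with `idx D ≠ j`, the component `V(x_j)` leaves the chart, the new exceptional component reads `(j, 0)`).

Second change (needed for hereditary regions, which must be CLOSED in the blown-up ambient and lie over the parent host): the waiting
region is the translated COORDINATE SUBSPACE `W^z_T = {x : z ∈ 𝔭_x, x_i − c_i ∈ 𝔭_x (i ∈ T)} = V(z, x_T − c_T)` (with the `z`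
condition) instead of the linear `{x_T = c_T}`; the model kid `V(z, x_T)` still maps into it because the waiting component is
Hironaka-permissible for the HOST state (`p ≤ ord_{(x_T)} s.F(x + c)`, the root-form datum of parts 31/55a): §1 proves
`z^p + s.F ∈ 𝔭_{B φ₀ y}` from the chart dictionary and the kid's permissibility (sheaf inequality
`B^*(z^p + s.F) ≤ σᶜ`, `φ₀^* σᶜ = (z^p + kid.F) ≤ 𝓘Λ_T`) and then `z ∈ 𝔭_{B φ₀ y}` from `s.F ∈ (x_T − c_T)`.

* §1 `rename_mem_asIdeal_of_translate_mem_span`, `hyp_mem_asIdeal_B_chart_apply_of_mem_CΛ`, `X_zero_mem_B_chart_apply_of_mem_CΛ`;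
* §2 **`waiting_kid_package_of_shape`** — part 44's conclusion (closed kid, re-centring `Θ`, model description through `ε`, projection
  into `φ(ψ⁻¹ W^z_T)`, non-empty, regular, snc with `(M.transform π Zc).boundary`, zigzag chart reading the kid state and `𝓘Λ T`, ranges,
  translated shape `(idx₂, cst₂)` with `idx₂ D₂ ∈ T → cst₂ D₂ = 0`, injectivity) under the SHAPE hypotheses instead of disjointness.

HONEST SCOPE: an old component reading `V(x_j + d)`, `d ≠ 0` (parallel to the kid's exceptional divisor) across the waiting region is
excluded by `idx D ∈ S → cst D = 0` although the kid would be snc with it — the forest's injective-index format, not geometry.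
AI-produced formalisation, weaker than expert review. bears_on: LADDER-RESOLUTION:D157-DOOR2 (res-dim4-pi · S3 (c) joint v3 · hereditary waiting).
-/

set_option linter.dupNamespace false -- D-0017: single-problem summit path `Summit.<S>.<S>.…` by design

noncomputable section

open MvPolynomial Finset CategoryTheory AlgebraicGeometry Opposite TopologicalSpace
open AlgebraicGeometry.Scheme.IdealSheafData (ofIdealTop vanishingIdeal)

namespace Summit.ResolutionOfSingularities.ResolutionOfSingularities.Theorems.PIDim4

open Literature.AlgebraicGeometry.Resolution
open Literature.AlgebraicGeometry.Resolution.Hauser2010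
open Literature.AlgebraicGeometry.Resolution.AffinePointBlowup (P A γ coord Wtop ξ)

namespace Equimultiple

/-! ## §1 Model: the re-centred chart maps `V(z, x_T)` into `V(z^p + s.F)` and into `V(z)` -/

section Model

variable {K : Type} [Field K] {Bl : Scheme.{0}} {B : Bl ⟶ P 4 K} {S T : Finset (Fin 4)} {j : Fin 4}

/-- **Translating back into an ideal**: if `G(x + c) ∈ (x_i : i ∈ T)` and a prime `𝔭` of `K[z, x]` contains `x_i − c_i` for every `i ∈ T`,
then `G(x) ∈ 𝔭` (as a polynomial in `K[z, x]`). [folklore] -/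
theorem rename_mem_asIdeal_of_translate_mem_span {c : Fin 4 → K} {G : MvPolynomial (Fin 4) K}
    (hG : PointBlowup.translate c G ∈ Ideal.span (X '' (T : Set (Fin 4)) : Set (MvPolynomial (Fin 4) K)))
    {q : Ideal (A 4 K)} (hq : ∀ i ∈ T, (X i.succ - C (c i) : A 4 K) ∈ q) :
    (rename Fin.succ G : A 4 K) ∈ q := by
  set f : MvPolynomial (Fin 4) K →ₐ[K] A 4 K := aeval fun i => (X i.succ - C (c i) : A 4 K) with hf
  have hfG : f (PointBlowup.translate c G) = rename Fin.succ G := by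
    rw [hf, PointBlowup.translate, ← AlgHom.comp_apply, MvPolynomial.comp_aeval]
    have h : (fun i => aeval (fun i => (X i.succ - C (c i) : A 4 K)) (X i + C (c i) : MvPolynomial (Fin 4) K)) =
        fun i => (X i.succ : A 4 K) := by
      funext i
      simp only [map_add, aeval_X, algHom_C, algebraMap_eq, sub_add_cancel]
    rw [h, rename_eq_aeval]
    rfl
  rw [← hfG]
  have hle : (Ideal.span (X '' (T : Set (Fin 4)) : Set (MvPolynomial (Fin 4) K))).map f ≤ q := by
    rw [Ideal.map_span, Ideal.span_le]
    rintro _ ⟨_, ⟨i, hi, rfl⟩, rfl⟩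
    simpa only [hf, aeval_X, SetLike.mem_coe] using hq i (Finset.mem_coe.mp hi)
  exact hle (Ideal.mem_map_of_mem f hG)

/-- **The re-centred chart maps `V(z, x_T)` into the hypersurface `V(z^p + s.F)`.** With `φ₀ = Spec Θ′ ≫ chartImm_j` reading the
controlled transform as `(z^p + G)·𝒪` (the chart dictionary) and `V(z, x_T)` permissible for `z^p + G` (`p ≤ ord_{(x_T)} G`):
`B^*(z^p + F) ≤ σᶜ((z^p + F)·𝒪, p)` and `φ₀^* σᶜ = (z^p + G)·𝒪 ≤ 𝓘Λ_T`, so `z^p + F ∈ 𝔭_{B(φ₀ y)}` for every `y ∈ V(z, x_T)`.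
[cite: BierstoneGrigorievMilmanWlodarczyk2011, Def. 3.1.3 (3) (controlled transform)] [cite: Hu2025, §5 Prop. 5.3] -/
theorem hyp_mem_asIdeal_B_chart_apply_of_mem_CΛ {p : ℕ} (hp : p ≠ 0)
    (hB : IsBlowup B (AffineCoordBlowup.𝓘Λ 4 K (insert 0 (Fin.succ '' (S : Set (Fin 4))))))
    (hj : j ∈ S) (Θ' : A 4 K →+* A 4 K) (F G : MvPolynomial (Fin 4) K)
    (hc : (controlledTransform B (AffineCoordBlowup.𝓘Λ 4 K (insert 0 (Fin.succ '' (S : Set (Fin 4)))))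
        (hypSheaf p F) p).comap
        (Spec.map (CommRingCat.ofHom Θ') ≫ AffineCoordBlowup.chartImm hB (ChartDictionary.succ_mem_centreVars hj)) =
      hypSheaf p G)
    (hG : (p : ℕ∞) ≤ CentreBlowup.ordAlong T G) {y : P 4 K}
    (hy : y ∈ AffineCoordBlowup.CΛ 4 K (insert 0 (Fin.succ '' (T : Set (Fin 4))))) :
    (hyp p F : A 4 K) ∈
      (B ((Spec.map (CommRingCat.ofHom Θ') ≫
        AffineCoordBlowup.chartImm hB (ChartDictionary.succ_mem_centreVars hj)) y)).asIdeal := by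
  set φ₀ := Spec.map (CommRingCat.ofHom Θ') ≫
    AffineCoordBlowup.chartImm hB (ChartDictionary.succ_mem_centreVars hj) with hφ₀
  have h1 : ((hypSheaf p F).comap B).comap φ₀ ≤ hypSheaf p G := by
    rw [← hc]
    exact Scheme.IdealSheafData.comap_mono φ₀ (comap_le_controlledTransform B _ (hypSheaf p F) p)
  have h2 : hypSheaf p G ≤ AffineCoordBlowup.𝓘Λ 4 K (insert 0 (Fin.succ '' (T : Set (Fin 4)))) :=
    ChartDictionary.ofIdealTop_span_le_𝓘Λ (Ideal.pow_le_self hp (ChartDictionary.hyp_mem_IΛ_pow p T G hG))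
  have h3 : y ∈ (((hypSheaf p F).comap B).comap φ₀).support :=
    Scheme.IdealSheafData.support_antitone (h1.trans h2) (by rw [AffineCoordBlowup.support_𝓘Λ]; exact hy)
  rw [Scheme.IdealSheafData.support_comap, Scheme.IdealSheafData.support_comap] at h3
  have h4 : B (φ₀ y) ∈ ((hypSheaf p F).support : Set (P 4 K)) := h3
  rw [hypSheaf, ofIdealTop_span_γ_symm_eq_shf, SetLike.mem_coe,
    Literature.AlgebraicGeometry.Hironaka2017.SpecOrders.mem_support_shf_iff, Ideal.span_singleton_le_iff_mem] at h4
  exact h4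

/-- **… and into `V(z)`**, when the waiting component is permissible for the HOST state: for a re-centring `Θ′` at `c` (`c_j = 0`,
`c|_S = 0`, `j ∉ T`) with `p ≤ ord_{(x_T)} F(x + c)`, every `y ∈ V(z, x_T)` has `z ∈ 𝔭_{B(φ₀ y)}`: by part 35 the point contains
`x_i − c_i` (`i ∈ T`), hence `F` (translate back), hence `z^p = (z^p + F) − F`, hence `z`. [cite: Hauser2010, §§F–G]
[cite: HauserPerlega2019PRIMS, §2 (condition (1))] -/
theorem X_zero_mem_B_chart_apply_of_mem_CΛ {p : ℕ} (hp : p ≠ 0)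
    (hB : IsBlowup B (AffineCoordBlowup.𝓘Λ 4 K (insert 0 (Fin.succ '' (S : Set (Fin 4))))))
    (hj : j ∈ S) (hjT : j ∉ T) {Θ' : A 4 K →+* A 4 K} {c : Fin 4 → K} (hcj : c j = 0)
    (hcS : ∀ i ∈ S, c i = 0) (hC : ∀ r : K, Θ' (C r) = C r) (hs' : ∀ k : Fin 4, Θ' (X k.succ) = X k.succ + C (c k))
    (F G : MvPolynomial (Fin 4) K)
    (hc : (controlledTransform B (AffineCoordBlowup.𝓘Λ 4 K (insert 0 (Fin.succ '' (S : Set (Fin 4)))))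
        (hypSheaf p F) p).comap
        (Spec.map (CommRingCat.ofHom Θ') ≫ AffineCoordBlowup.chartImm hB (ChartDictionary.succ_mem_centreVars hj)) =
      hypSheaf p G)
    (hG : (p : ℕ∞) ≤ CentreBlowup.ordAlong T G) (hW : (p : ℕ∞) ≤ CentreBlowup.ordAlong T (PointBlowup.translate c F))
    {y : P 4 K} (hy : y ∈ AffineCoordBlowup.CΛ 4 K (insert 0 (Fin.succ '' (T : Set (Fin 4))))) :
    (X 0 : A 4 K) ∈
      (B ((Spec.map (CommRingCat.ofHom Θ') ≫
        AffineCoordBlowup.chartImm hB (ChartDictionary.succ_mem_centreVars hj)) y)).asIdeal := by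
  have hhyp := hyp_mem_asIdeal_B_chart_apply_of_mem_CΛ hp hB hj Θ' F G hc hG hy
  have hx : ∀ i ∈ T, (X i.succ - C (c i) : A 4 K) ∈
      (B ((Spec.map (CommRingCat.ofHom Θ') ≫
        AffineCoordBlowup.chartImm hB (ChartDictionary.succ_mem_centreVars hj)) y)).asIdeal := fun i hi =>
    X_sub_C_mem_B_chart_apply_of_mem_CΛ hB hj hjT hcj hcS hC hs' hy hi
  have hF := rename_mem_asIdeal_of_translate_mem_span
    (Ideal.pow_le_self hp (ChartDictionary.mem_pow_span_X_of_le_ordAlong p T _ hW)) hx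
  have hz : (X 0 : A 4 K) ^ p ∈
      (B ((Spec.map (CommRingCat.ofHom Θ') ≫
        AffineCoordBlowup.chartImm hB (ChartDictionary.succ_mem_centreVars hj)) y)).asIdeal := by
    have h := Ideal.sub_mem _ hhyp hF
    rwa [hyp, add_sub_cancel_right] at h
  exact Ideal.IsPrime.mem_of_pow_mem inferInstance p hz

end Model

/-! ## §2 The waiting kid with translated boundary shape -/

section WaitingKidShape

variable {K : Type} [Field K] {p : ℕ} [hp : Fact p.Prime] [CharP K p] [DecidableEq K]
variable {Z Y W Bl : Scheme.{0}} (φ : Y ⟶ Z) [IsOpenImmersion φ] (ψ : Y ⟶ P 4 K) [IsOpenImmersion ψ]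
  {π : W ⟶ Z} {B : Bl ⟶ P 4 K} {S : Finset (Fin 4)}
  (ε : (π ⁻¹ᵁ φ.opensRange : Scheme.{0}) ≅ (B ⁻¹ᵁ ψ.opensRange : Scheme.{0}))

/-- **THE WAITING KID WITH TRANSLATED BOUNDARY SHAPE** (waiting regions meeting the boundary; the `z`-form region
`W^z_T = V(z, x_T − c_T)`). Setting of parts 35/44: host member of `(Z, M)` read through the zigzag chart `Z ←φ— Y —ψ→ 𝔸⁵` with centre
`Zc` reading `𝓘Λ S` and state `s`; `π` a blowing up along `Zc`, `B` a model blowing up of `V(z, x_S)`, `ε` the comparison. Waiting entry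
`(j, c, T)`: `j ∈ S`, `c_j = 0`, `c|_S = 0`, `S ∖ {j} ⊆ T`, `j ∉ T`, `V(z, x_T)` permissible for the HOST state translated to `c`
(`hW`) and for the KID state (`hpermT`); the host chart sees `W^z_T` (`hWsee`) with closed image (`hWc`); every OLD boundary component
meeting `φ(ψ⁻¹ W^z_T)` reads `ψ^* V(x_{idx D} + cst D)` with `cst D = 0` when `idx D ∈ S`, indices injective on those components
(`hWshape`, `hWinj`). Conclusion: part 44's — closed kid `c″`, re-centring `Θ`, model description through `ε`, projection into
`φ(ψ⁻¹ W^z_T)`, non-empty, regular, snc with `(M.transform π Zc).boundary`, zigzag chart reading the kid state and `𝓘Λ T`, ranges,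
translated shape with `idx₂ D₂ ∈ T → cst₂ D₂ = 0`, injectivity. [cite: BierstoneGrigorievMilmanWlodarczyk2011, Def. 3.1.3 (1)–(2), (4)]
[cite: GortzWedhorn2020, Prop. 13.91] [cite: Hauser2010, §G (transversal strict transforms in the chart expression)] -/
theorem waiting_kid_package_of_shape [IsLocallyNoetherian Z] [IsAlgClosed K] (Zc : Z.IdealSheafData)
    (hπ : IsBlowup π Zc) (hB : IsBlowup B (AffineCoordBlowup.𝓘Λ 4 K (insert 0 (Fin.succ '' (S : Set (Fin 4))))))
    (hsq : ε.hom ≫ (B ∣_ ψ.opensRange) = (π ∣_ φ.opensRange) ≫ (φ.isoOpensRange.inv ≫ ψ.isoOpensRange.hom))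
    (hC' : ((AffineCoordBlowup.𝓘Λ 4 K (insert 0 (Fin.succ '' (S : Set (Fin 4))))).comap ψ.opensRange.ι).comap
        (φ.isoOpensRange.inv ≫ ψ.isoOpensRange.hom) = Zc.comap φ.opensRange.ι)
    (M : MarkedIdeal Z) (hmult : M.mult = p) (s : State K)
    (hKEY : ((controlledTransform B (AffineCoordBlowup.𝓘Λ 4 K (insert 0 (Fin.succ '' (S : Set (Fin 4)))))
        (hypSheaf p s.F) p).comap (B ⁻¹ᵁ ψ.opensRange).ι).comap ε.hom =
      (controlledTransform π Zc M.ideal p).comap (π ⁻¹ᵁ φ.opensRange).ι)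
    (hperm : (p : ℕ∞) ≤ CentreBlowup.ordAlong S s.F)
    (hsee : (AffineCoordBlowup.CΛ 4 K (insert 0 (Fin.succ '' (S : Set (Fin 4)))) : Set (P 4 K)) ⊆ Set.range ψ)
    (hT : IsClosed (φ '' (ψ ⁻¹' (AffineCoordBlowup.CΛ 4 K (insert 0 (Fin.succ '' (S : Set (Fin 4)))) : Set (P 4 K)))))
    (hsncZ : HasSNCWith M.boundary Zc)
    {j : Fin 4} (hj : j ∈ S) {c : Fin 4 → K} (hcj : c j = 0) (hcS : ∀ i ∈ S, c i = 0)
    {T : Finset (Fin 4)} (hsub : S.erase j ⊆ T) (hjT : j ∉ T)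
    (hW : (p : ℕ∞) ≤ CentreBlowup.ordAlong T (PointBlowup.translate c s.F))
    (hpermT : (p : ℕ∞) ≤ CentreBlowup.ordAlong T (CentreBlowup.step p S j c s).F)
    (hWsee : {x : P 4 K | (X 0 : A 4 K) ∈ x.asIdeal ∧ ∀ i ∈ T, (X i.succ - C (c i) : A 4 K) ∈ x.asIdeal} ⊆ Set.range ψ)
    (hWc : IsClosed (φ '' (ψ ⁻¹' {x : P 4 K | (X 0 : A 4 K) ∈ x.asIdeal ∧ ∀ i ∈ T, (X i.succ - C (c i) : A 4 K) ∈ x.asIdeal})))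
    (idx : Z.IdealSheafData → Fin 4) (cst : Z.IdealSheafData → K)
    (hWshape : ∀ D ∈ M.boundary, ((D.support : Set Z) ∩ φ '' (ψ ⁻¹' {x : P 4 K | (X 0 : A 4 K) ∈ x.asIdeal ∧ ∀ i ∈ T, (X i.succ - C (c i) : A 4 K) ∈ x.asIdeal})).Nonempty →
      D.comap φ = (ofIdealTop (Ideal.span {(γ 4 K).symm (X (idx D).succ + C (cst D))})).comap ψ ∧
        (idx D ∈ S → cst D = 0))
    (hWinj : ∀ D₁ ∈ M.boundary, ∀ D₂ ∈ M.boundary,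
      ((D₁.support : Set Z) ∩ φ '' (ψ ⁻¹' {x : P 4 K | (X 0 : A 4 K) ∈ x.asIdeal ∧ ∀ i ∈ T, (X i.succ - C (c i) : A 4 K) ∈ x.asIdeal})).Nonempty → ((D₂.support : Set Z) ∩ φ '' (ψ ⁻¹' {x : P 4 K | (X 0 : A 4 K) ∈ x.asIdeal ∧ ∀ i ∈ T, (X i.succ - C (c i) : A 4 K) ∈ x.asIdeal})).Nonempty →
      idx D₁ = idx D₂ → D₁ = D₂) :
    ∃ (c'' : Closeds W) (Θ : A 4 K ≃ₐ[K] A 4 K),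
      (∀ i : Fin 4, Θ (X i.succ) = X i.succ + C (c i)) ∧
      (controlledTransform B (AffineCoordBlowup.𝓘Λ 4 K (insert 0 (Fin.succ '' (S : Set (Fin 4))))) (hypSheaf p s.F) p).comap
          (Spec.map (CommRingCat.ofHom (Θ : A 4 K →+* A 4 K)) ≫
            AffineCoordBlowup.chartImm hB (ChartDictionary.succ_mem_centreVars hj)) =
        hypSheaf p (CentreBlowup.step p S j c s).F ∧
      (∀ (w : W) (hwV : w ∈ π ⁻¹ᵁ φ.opensRange), w ∈ (c'' : Set W) ↔
        ((B ⁻¹ᵁ ψ.opensRange).ι (ε.hom ⟨w, hwV⟩) : Bl) ∈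
          (Spec.map (CommRingCat.ofHom (Θ : A 4 K →+* A 4 K)) ≫
            AffineCoordBlowup.chartImm hB (ChartDictionary.succ_mem_centreVars hj)) '' (AffineCoordBlowup.CΛ 4 K (insert 0 (Fin.succ '' (T : Set (Fin 4)))) : Set (P 4 K))) ∧
      (∀ w ∈ (c'' : Set W), π w ∈ φ '' (ψ ⁻¹' {x : P 4 K | (X 0 : A 4 K) ∈ x.asIdeal ∧ ∀ i ∈ T, (X i.succ - C (c i) : A 4 K) ∈ x.asIdeal})) ∧
      (c'' : Set W).Nonempty ∧
      Scheme.IsRegular (vanishingIdeal c'').subscheme ∧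
      HasSNCWith (M.transform π Zc).boundary (vanishingIdeal c'') ∧
      ∃ (Y'' : Scheme.{0}) (φ'' : Y'' ⟶ W) (ψ'' : Y'' ⟶ P 4 K) (_ : IsOpenImmersion φ'') (_ : IsOpenImmersion ψ''),
        (M.transform π Zc).ideal.comap φ'' = (hypSheaf p (CentreBlowup.step p S j c s).F).comap ψ'' ∧
        (vanishingIdeal c'').comap φ'' =
          (AffineCoordBlowup.𝓘Λ 4 K (insert 0 (Fin.succ '' (T : Set (Fin 4))))).comap ψ'' ∧
        (c'' : Set W) ⊆ Set.range φ'' ∧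
        (AffineCoordBlowup.CΛ 4 K (insert 0 (Fin.succ '' (T : Set (Fin 4)))) : Set (P 4 K)) ⊆ Set.range ψ'' ∧
        ∃ (idx₂ : W.IdealSheafData → Fin 4) (cst₂ : W.IdealSheafData → K),
          (∀ D₂ ∈ (M.transform π Zc).boundary,
            ((D₂.support : Set W) ∩ φ'' '' (ψ'' ⁻¹' (AffineCoordBlowup.CΛ 4 K (insert 0 (Fin.succ '' (T : Set (Fin 4)))) : Set (P 4 K)))).Nonempty →
            D₂.comap φ'' = (ofIdealTop (Ideal.span {(γ 4 K).symm (X (idx₂ D₂).succ + C (cst₂ D₂))})).comap ψ'' ∧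
              (idx₂ D₂ ∈ T → cst₂ D₂ = 0)) ∧
          (∀ D₁ ∈ (M.transform π Zc).boundary, ∀ D₂ ∈ (M.transform π Zc).boundary,
            ((D₁.support : Set W) ∩ φ'' '' (ψ'' ⁻¹' (AffineCoordBlowup.CΛ 4 K (insert 0 (Fin.succ '' (T : Set (Fin 4)))) : Set (P 4 K)))).Nonempty →
            ((D₂.support : Set W) ∩ φ'' '' (ψ'' ⁻¹' (AffineCoordBlowup.CΛ 4 K (insert 0 (Fin.succ '' (T : Set (Fin 4)))) : Set (P 4 K)))).Nonempty →
            idx₂ D₁ = idx₂ D₂ → D₁ = D₂) := by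
  classical
  haveI : PerfectRing K p := PerfectRing.ofSurjective K p fun x => IsAlgClosed.exists_pow_nat_eq x hp.out.pos
  haveI : IsProper π := hπ.isProper
  haveI : IsLocallyNoetherian W := LocallyOfFiniteType.isLocallyNoetherian π
  haveI : IsProper B := hB.isProper
  haveI : IsLocallyNoetherian Bl := LocallyOfFiniteType.isLocallyNoetherian B
  have hp0 : p ≠ 0 := hp.out.ne_zero
  have hK := hKEY
  set Rz : Set (P 4 K) := {x : P 4 K | (X 0 : A 4 K) ∈ x.asIdeal ∧ ∀ i ∈ T, (X i.succ - C (c i) : A 4 K) ∈ x.asIdeal} with hRz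
  set TW : Set Z := φ '' (ψ ⁻¹' Rz) with hTW
  obtain ⟨Θ, h, h0, hs, hc⟩ := ChartDictionary.controlledTransform_chart_eq_step p hj hcj s hperm hB
  haveI := isOpenImmersion_specMap_algEquiv Θ
  have hsR : ∀ k : Fin 4, (Θ : A 4 K →+* A 4 K) (X k.succ) = X k.succ + C (c k) := fun k => hs k
  have hCR : ∀ r : K, (Θ : A 4 K →+* A 4 K) (C r) = C r := fun r => Θ.commutes r
  obtain ⟨hread, hexc, -⟩ :=
    ChartDictionary.zigzag_chart_of_chart φ ψ M hmult s.F (CentreBlowup.step p S j c s).F Zc hsee hT hB ε hsq hC' hK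
      hj hcj h0 hs hc
  set φ₀ : P 4 K ⟶ Bl := Spec.map (CommRingCat.ofHom (Θ : A 4 K →+* A 4 K)) ≫
    AffineCoordBlowup.chartImm hB (ChartDictionary.succ_mem_centreVars hj) with hφ₀
  set φ'' := (φ₀ ∣_ (B ⁻¹ᵁ ψ.opensRange)) ≫ ε.inv ≫ (π ⁻¹ᵁ φ.opensRange).ι with hφ''
  set ψ'' := (φ₀ ⁻¹ᵁ (B ⁻¹ᵁ ψ.opensRange)).ι with hψ''
  haveI : IsOpenImmersion φ₀ := by rw [hφ₀]; infer_instance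
  haveI : IsOpenImmersion φ'' := by rw [hφ'']; infer_instance
  -- the model chart maps the next centre into `W^z_T`, which the host chart sees
  have hTD : ∀ y ∈ (AffineCoordBlowup.CΛ 4 K (insert 0 (Fin.succ '' (T : Set (Fin 4)))) : Set (P 4 K)), B (φ₀ y) ∈ Rz := fun y hy =>
    ⟨X_zero_mem_B_chart_apply_of_mem_CΛ hp0 hB hj hjT hcj hcS hCR hsR s.F _ hc hpermT hW hy,
      fun i hi => X_sub_C_mem_B_chart_apply_of_mem_CΛ hB hj hjT hcj hcS hCR hsR hy hi⟩
  have hsee'' : (AffineCoordBlowup.CΛ 4 K (insert 0 (Fin.succ '' (T : Set (Fin 4)))) : Set (P 4 K)) ⊆ Set.range ψ'' :=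
    ChartDictionary.zigzag_transport_range ψ φ₀ _ fun y hy => hWsee (hTD y hy)
  -- closedness: typ-2's `erase` criterion on the model, transported over `W^z_T`
  have hclosed'' : IsClosed (φ'' '' (ψ'' ⁻¹' (AffineCoordBlowup.CΛ 4 K (insert 0 (Fin.succ '' (T : Set (Fin 4)))) : Set (P 4 K)))) :=
    ChartDictionary.zigzag_transport_isClosed φ ψ ε φ₀ hsq _ _
      (ChartDictionary.isClosed_image_CΛ_chart hj hcj h0 hs hB hsub) hWc hTD
  set c'' : Closeds W := closureImage φ'' ((((AffineCoordBlowup.𝓘Λ 4 K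
    (insert 0 (Fin.succ '' (T : Set (Fin 4))))).comap ψ'').support :
      Set (φ₀ ⁻¹ᵁ (B ⁻¹ᵁ ψ.opensRange)))) with hc''
  have hcoe : (c'' : Set W) = φ'' '' (ψ'' ⁻¹' (AffineCoordBlowup.CΛ 4 K (insert 0 (Fin.succ '' (T : Set (Fin 4)))) : Set (P 4 K))) := by
    rw [hc'', coe_closureImage, ChartDictionary.coe_support_comap_𝓘Λ ψ'', hclosed''.closure_eq]
  set T'' : Set W := φ'' '' (ψ'' ⁻¹' (AffineCoordBlowup.CΛ 4 K (insert 0 (Fin.succ '' (T : Set (Fin 4)))) : Set (P 4 K))) with hT''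
  -- the kid projects into `φ(ψ⁻¹ W^z_T)`
  have hproj : ∀ w ∈ T'', π w ∈ TW := by
    rintro _ ⟨y, hy, rfl⟩
    obtain ⟨hπy, hψy⟩ := ChartDictionary.zigzag_transport_π_apply φ ψ ε φ₀ hsq y
    rw [hπy]
    refine ⟨_, ?_, rfl⟩
    rw [Set.mem_preimage, hψy]
    exact hTD y.1 hy
  -- SHAPE TRANSPORT (typ-2's `shapeT_transform_zigzag`, with the waiting region as the meeting set downstairs)
  have hmeet_old : ∀ D ∈ M.boundary, (((strictTransformIdeal π Zc D).support : Set W) ∩ T'').Nonempty →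
      ((D.support : Set Z) ∩ TW).Nonempty := by
    rintro D - ⟨w, hw1, hw2⟩
    exact ⟨π w, ChartDictionary.support_strictTransformIdeal_subset_preimage π _ D hw1, hproj w hw2⟩
  have hreadD : ∀ D ∈ M.boundary, ((D.support : Set Z) ∩ TW).Nonempty → idx D ≠ j →
      (strictTransformIdeal π Zc D).comap φ'' =
        (ofIdealTop (Ideal.span {(γ 4 K).symm (X (idx D).succ + C (cst D + c (idx D)))})).comap ψ'' := by
    intro D hD hm hij
    obtain ⟨hDi, hcst⟩ := hWshape D hD hm
    have htr := ChartDictionary.zigzag_transport_strictTransform φ ψ ε _ Zc hsq hC' D _ hDi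
    rw [hφ'', ChartDictionary.zigzag_transport_comap φ ψ ε φ₀ _ _ htr, hψ'']
    congr 1
    by_cases hiS : idx D ∈ S
    · rw [hcst hiS, C_0, add_zero, zero_add, hφ₀]
      exact ChartDictionary.comap_hyperplane_chart hj hij (hsR (idx D)) hB
    · rw [hφ₀]
      exact ChartDictionary.comap_translate_hyperplane_chart hj hiS (cst D) (hsR (idx D)) hCR hB
  have hself : ∀ D ∈ M.boundary, ((D.support : Set Z) ∩ TW).Nonempty → idx D = j →
      ¬ (((strictTransformIdeal π Zc D).support : Set W) ∩ T'').Nonempty := by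
    rintro D hD hm hij ⟨w, hw1, y, hy, rfl⟩
    obtain ⟨hDi, hcst⟩ := hWshape D hD hm
    rw [hcst (hij ▸ hj), C_0, add_zero, hij] at hDi
    have htr := ChartDictionary.zigzag_transport_strictTransform φ ψ ε _ Zc hsq hC' D _ hDi
    have hmodel : (strictTransformIdeal B (AffineCoordBlowup.𝓘Λ 4 K (insert 0 (Fin.succ '' (S : Set (Fin 4)))))
        (ofIdealTop (Ideal.span {(γ 4 K).symm (X j.succ)}))).comap φ₀ = ⊤ :=
      ChartDictionary.comap_hyperplane_self_chart hj _ hB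
    have htop : (strictTransformIdeal π Zc D).comap φ'' = ⊤ := by
      rw [hφ'', ChartDictionary.zigzag_transport_comap φ ψ ε φ₀ _ _ htr, hmodel, Scheme.IdealSheafData.comap_top]
    have h1 : y ∈ ((strictTransformIdeal π Zc D).comap φ'').support := by
      rw [Scheme.IdealSheafData.support_comap]; exact hw1
    rw [htop, Scheme.IdealSheafData.support_top] at h1
    exact h1
  have hnew : (Zc.comap π).comap φ'' = (ofIdealTop (Ideal.span {(γ 4 K).symm (X j.succ + C (0 : K))})).comap ψ'' := by
    rw [C_0, add_zero]
    exact hexc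
  have hmiss : ∀ (D₂ : W.IdealSheafData) (i : Fin 4) (e : K), i ∈ T → e ≠ 0 →
      D₂.comap φ'' = (ofIdealTop (Ideal.span {(γ 4 K).symm (X i.succ + C e)})).comap ψ'' →
      ¬ ((D₂.support : Set W) ∩ T'').Nonempty := by
    rintro D₂ i e hiT he hr ⟨w, hw1, y, hy, rfl⟩
    have h1 : y ∈ (D₂.comap φ'').support := by
      rw [Scheme.IdealSheafData.support_comap]; exact hw1
    rw [hr, Scheme.IdealSheafData.support_comap] at h1
    have h0 := ChartDictionary.support_translate_inter_CΛ_eq_empty (K := K) he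
      (Λ := insert 0 (Fin.succ '' (T : Set (Fin 4)))) (Set.mem_insert_of_mem _ ⟨_, hiT, rfl⟩)
    exact (Set.eq_empty_iff_forall_notMem.mp h0) (ψ'' y) ⟨h1, hy⟩
  -- preimages of strict transforms among the meeting components
  let pre : W.IdealSheafData → Z.IdealSheafData := fun D₂ =>
    if h : ∃ D ∈ M.boundary, ((D.support : Set Z) ∩ TW).Nonempty ∧ strictTransformIdeal π Zc D = D₂ then h.choose else ⊤
  have hpre : ∀ D ∈ M.boundary, ((D.support : Set Z) ∩ TW).Nonempty →
      pre (strictTransformIdeal π Zc D) ∈ M.boundary ∧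
        (((pre (strictTransformIdeal π Zc D)).support : Set Z) ∩ TW).Nonempty ∧
        strictTransformIdeal π Zc (pre (strictTransformIdeal π Zc D)) = strictTransformIdeal π Zc D := by
    intro D hD hm
    have hex : ∃ D' ∈ M.boundary, ((D'.support : Set Z) ∩ TW).Nonempty ∧
        strictTransformIdeal π Zc D' = strictTransformIdeal π Zc D := ⟨D, hD, hm, rfl⟩
    simp only [pre, dif_pos hex]
    exact ⟨hex.choose_spec.1, hex.choose_spec.2.1, hex.choose_spec.2.2⟩
  have key : ∀ D₀ ∈ (M.transform π Zc).boundary, D₀ ≠ Zc.comap π → ((D₀.support : Set W) ∩ T'').Nonempty →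
      pre D₀ ∈ M.boundary ∧ (((pre D₀).support : Set Z) ∩ TW).Nonempty ∧ strictTransformIdeal π Zc (pre D₀) = D₀ ∧
        idx (pre D₀) ≠ j := by
    intro D₀ hD₀ hne hm₀
    change D₀ ∈ M.boundary.map (strictTransformIdeal π Zc) ++ [Zc.comap π] at hD₀
    rw [List.mem_append, List.mem_map, List.mem_singleton] at hD₀
    rcases hD₀ with ⟨D, hD, rfl⟩ | h
    · obtain ⟨hpE, hpm, hpeq⟩ := hpre D hD (hmeet_old D hD hm₀)
      exact ⟨hpE, hpm, hpeq, fun h => hself _ hpE hpm h (hpeq.symm ▸ hm₀)⟩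
    · exact absurd h hne
  set idx₂ : W.IdealSheafData → Fin 4 := fun D₂ => if D₂ = Zc.comap π then j else idx (pre D₂) with hidx₂
  set cst₂ : W.IdealSheafData → K := fun D₂ => if D₂ = Zc.comap π then 0 else cst (pre D₂) + c (idx (pre D₂))
    with hcst₂
  have hshape₂ : ∀ D₂ ∈ (M.transform π Zc).boundary, ((D₂.support : Set W) ∩ T'').Nonempty →
      D₂.comap φ'' = (ofIdealTop (Ideal.span {(γ 4 K).symm (X (idx₂ D₂).succ + C (cst₂ D₂))})).comap ψ'' ∧
        (idx₂ D₂ ∈ T → cst₂ D₂ = 0) := by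
    intro D₂ hD₂ hm₂
    by_cases hnewD : D₂ = Zc.comap π
    · subst hnewD
      simp only [hidx₂, hcst₂, if_pos rfl]
      exact ⟨hnew, by simp⟩
    · simp only [hidx₂, hcst₂, if_neg hnewD]
      obtain ⟨hpE, hpm, hpeq, hpj⟩ := key D₂ hD₂ hnewD hm₂
      have hr := hreadD _ hpE hpm hpj
      rw [hpeq] at hr
      refine ⟨hr, fun hiT => ?_⟩
      by_contra hne
      exact hmiss _ _ _ hiT hne hr hm₂
  have hinj₂ : ∀ D₁ ∈ (M.transform π Zc).boundary, ∀ D₂ ∈ (M.transform π Zc).boundary,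
      ((D₁.support : Set W) ∩ T'').Nonempty → ((D₂.support : Set W) ∩ T'').Nonempty → idx₂ D₁ = idx₂ D₂ → D₁ = D₂ := by
    intro D₁ hD₁ D₂ hD₂ hm₁ hm₂ hidx
    by_cases h₁ : D₁ = Zc.comap π <;> by_cases h₂ : D₂ = Zc.comap π
    · rw [h₁, h₂]
    · simp only [hidx₂, if_pos h₁, if_neg h₂] at hidx
      exact absurd hidx.symm (key D₂ hD₂ h₂ hm₂).2.2.2
    · simp only [hidx₂, if_neg h₁, if_pos h₂] at hidx
      exact absurd hidx (key D₁ hD₁ h₁ hm₁).2.2.2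
    · simp only [hidx₂, if_neg h₁, if_neg h₂] at hidx
      obtain ⟨hp1E, hp1m, hp1eq, -⟩ := key D₁ hD₁ h₁ hm₁
      obtain ⟨hp2E, hp2m, hp2eq, -⟩ := key D₂ hD₂ h₂ hm₂
      rw [← hp1eq, ← hp2eq, hWinj _ hp1E _ hp2E hp1m hp2m hidx]
  have hE₂ : HasSNC (M.transform π Zc).boundary := MarkedIdeal.hasSNC_transform_boundary M hsncZ hπ
  have hEc₂ : HasSNCWith ((M.transform π Zc).boundary.map (·.comap φ''))
      ((AffineCoordBlowup.𝓘Λ 4 K (insert 0 (Fin.succ '' (T : Set (Fin 4))))).comap ψ'') :=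
    ChartDictionary.hasSNCWith_comap_of_shapeT_zigzag φ'' ψ'' hE₂ idx₂ cst₂ hshape₂ hinj₂
  -- non-emptiness: the origin of the chart lies on the kid
  have hξ : (ξ 4 K) ∈ AffineCoordBlowup.CΛ 4 K (insert 0 (Fin.succ '' (T : Set (Fin 4)))) := by
    rw [AffineCoordBlowup.mem_CΛ_iff']
    intro i _
    exact (mem_originIdeal_iff K (4 + 1)).mpr (constantCoeff_X K i)
  obtain ⟨y₀, hy₀⟩ := hsee'' hξ
  refine ⟨c'', Θ, hs, hc, fun w hwV => ?_, fun w hw => ?_, ⟨φ'' y₀, ?_⟩,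
    ChartDictionary.isRegular_globalCentre_zigzag φ'' ψ'' hclosed'',
    ChartDictionary.hasSNCWith_globalCentre_zigzag φ'' ψ'' hclosed'' hE₂ hEc₂, _, φ'', ψ'', inferInstance,
    inferInstance, hread, by rw [hc'']; exact ChartDictionary.comap_globalCentre_zigzag φ'' ψ'' _,
    by rw [hcoe]; exact Set.image_subset_range _ _, hsee'', idx₂, cst₂, hshape₂, hinj₂⟩
  · -- model description of the points of the kid
    rw [hcoe]
    exact mem_image_zigzag_chart_iff φ ψ ε φ₀ _ hwV
  · -- projection: the kid lies over the translated coordinate subspace `V(z, x_T − c_T)` seen through `(φ, ψ)`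
    rw [hcoe] at hw
    exact hproj w hw
  · -- non-emptiness
    rw [hcoe]
    exact ⟨y₀, by rw [Set.mem_preimage, hy₀]; exact hξ, rfl⟩

end WaitingKidShape

end Equimultiple

end Summit.ResolutionOfSingularities.ResolutionOfSingularities.Theorems.PIDim4

end
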